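import Summits.QuantumFields.YangMills.Theorems.BalabanUVNodesN15KingModelCovariantKatoDomination
import HarnessLib

/-!
# BalabanUVNodes ∕ N15 — THE KING-MODEL RUNG (PART Ͱ-d): WHAT THE CURVED CASE ADDS — THE COVARIANT DIRICHLET FORM `Re⟨v,(−cΔ_U+m²)v⟩ = m²Σ_x‖v_x‖² + cΣ_{x,μ}‖v_x − U(x,μ)v_{x+e_μ}‖²`,
# ZERO MODES = PARALLEL SECTIONS, AND FOR `U(1)` LINKS: THE MASSLESS COVARIANT LAPLACIAN IS INVERTIBLE IFF `U` IS NOT A PURE GAUGE (strict diamagnetism of the spectral bottom)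
# (Track A, DAG node N15 = NE2; FAN-OUT v1.1 §N15 s3 «KING-MODEL RUNG … + the one-line statement of what the curved case adds»; count-neutral)

HONEST FRAMING.  Count-neutral (cell `pub-ymgap`, seat `pub-ymgap-dag-n15-e` g42; `--supports stmt-QuantumFields-27247 --as helper` = K3ᴬ, KEY MAP v3).  Finite torus, fixed spacing;
folklore lattice gauge theory (Wilson ∕ Kogut–Susskind kinematics) on King's `A = 0` comparison model; NOT Bałaban's `G_k(U)`; NOT a node discharge; nothing continuum ∕ ℝ⁴ ∕ OS ∕ Clay.

THE RESULTS (every period vector `K`, fibre `𝕜ⁿ`, unitary link field `U`; `M_U = −cΔ_U + m²` of PART Ͱ-a, `fib v x ∈ EuclideanSpace 𝕜 n` of PART Ͱ-b):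
* §1 `eq_of_forall_add_unitVec` — a function on the torus invariant under every `x ↦ x + e_μ` is constant (the torus graph is connected);
* §2 ★★★ **`re_quadForm_covLapF`** — THE COVARIANT DIRICHLET FORM: `Re⟨v, M_Uv⟩ = m²·Σ_x‖v_x‖² + c·Σ_xΣ_μ‖v_x − U(x,μ)v_{x+e_μ}‖²` (the tree's bond-by-bond `Hopping.quadForm_coupling`
  [BrydgesFrohlichSeiler1979 ∕ Balaban1982Higgs2 (3.38)] completed to squares with `‖U(x,μ)w‖ = ‖w‖`; [Balaban1985BackgroundPropagators] (3.23) `⟨f,Δ_Uf⟩ = ‖D_Uf‖²`); ★★ `posSemidef_covLapF`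
  (`m² ≥ 0`); `im_quadForm_covLapF` (`= 0`);
* §3 ★★★ **`covLapF_massless_mulVec_eq_zero_iff`** — ZERO MODES OF THE MASSLESS OPERATOR ARE THE PARALLEL SECTIONS: `(−cΔ_U)v = 0 ↔ ∀ x μ, v_x = U(x,μ)v_{x+e_μ}` (`c > 0`);
  ★ `norm_fib_eq_of_parallel` (a parallel section has constant fibre norm);
* §4 `U(1)` LINKS (`n = Unit`): ★★★ **`exists_zeroMode_iff_pureGauge`** — `(∃ v ≠ 0, (−cΔ_U)v = 0) ↔ ∃ g : T → U(1), U(x,μ) = g(x)g(x+e_μ)^*` (the parallel section, normalised, IS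
  the gauge); ★★★ **`posDef_covLapF_massless_iff`** — `−cΔ_U` is positive DEFINITE iff `U` is NOT a pure gauge: off the gauge orbit of `U ≡ 1` the bottom of the spectrum is
  STRICTLY positive (strict form of [DodziukMathai2006] Cor. 1.3 `λ₀(Δ) ≤ λ₀(Δ_σ)` on a finite torus), while ★ `not_posDef_covLapF_massless_free` — King's own massless `c(−Δ) ⊗ 1`
  has the constants in its kernel.  THIS is what the curved case adds to N15's fine layer: magnitudes never grow (Ͱ-b∕c), and a field with non-trivial holonomy LIFTS the
  spectral bottom.

PRIOR TREE ART (by name): Ͱ-a (`covLapF`, `covLapF_eq`, `kingHopping`, `isHermitian_covLapF`, `free_mem_unitaryGroup`, `kingGaugeAct`, `isUnit_covLapF`), Ͱ-b (`fib`, `fib_apply`,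
`norm_apply_le_norm_fib`, `norm_toEuclideanLin_of_mem_unitaryGroup`), `LatticeDiamagneticInequality.Hopping.quadForm_coupling` (+ `comp`), Mathlib (`Matrix.PosSemidef.dotProduct_mulVec_zero_iff`,
`PosDef.of_dotProduct_mulVec_pos`, `norm_sub_sq`, `EuclideanSpace.inner_toLp_toLp`).  Dedup (rg at filing): basename 0 files; needles
`re_quadForm_covLapF|covLapF_massless_mulVec_eq_zero_iff|exists_zeroMode_iff_pureGauge|posDef_covLapF_massless_iff|eq_of_forall_add_unitVec` 0 tree files.
presearch: «magnetic Laplacian on a finite graph: λ₀ = 0 iff the multiplier is a coboundary» → [corpus: paper:arxiv-math_0312450 §1 Cor 1.3] gives `λ₀(Δ) ≤ λ₀(Δ_σ)` only; the iff is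
folklore (Lieb–Loss 1993 ∕ Higuchi–Shirai 1999, not held) and is PROVED here.  Locators: [Balaban1985BackgroundPropagators] (3.23) p.394, p.398 l.1–2; [DodziukMathai2006] §1 Lemma 1.2,
Cor 1.3; [Balaban1982Higgs2] (3.38) p.591; [King1986] (4.4) p.670.  0 `sorry`, 0 `def`.
-/

noncomputable section

open scoped BigOperators ComplexConjugate ComplexOrder Kronecker InnerProductSpace
open Finset Matrix WithLp

namespace Summit.QuantumFields.YangMills.BalabanUVNodes.N15KingModelRung.Covariant

open Literature.MathematicalPhysics.QuantumFieldTheory.LatticeDiamagneticInequality (Hopping blk placed comp)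
open Literature.MathematicalPhysics.QuantumFieldTheory.Balaban1983to89.B5Prop11Plancherel (Tor unitVec)
open Literature.MathematicalPhysics.QuantumFieldTheory.King1986.Torus (lapF)

variable {d : ℕ} (K : Fin (d + 1) → ℕ)

/-! ## §1 The torus is connected by the unit steps -/

section Connected

variable [hK : ∀ μ, NeZero (K μ)]

/-- A function on `Π_μℤ∕K_μ` invariant under every unit step `x ↦ x + e_μ` is invariant under all translations. [folklore] -/
theorem eq_of_forall_add_unitVec {α : Type*} {f : Tor K → α} (h : ∀ x μ, f (x + unitVec K μ) = f x) (x y : Tor K) : f (x + y) = f x := by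
  have hstep : ∀ (μ : Fin (d + 1)) (k : ℕ) (z : Tor K), f (z + k • unitVec K μ) = f z := by
    intro μ k
    induction k with
    | zero => intro z; rw [zero_smul, add_zero]
    | succ k ih => intro z; rw [add_smul, one_smul, ← add_assoc, h, ih]
  have hy : y = ∑ μ, ((y μ).val : ℕ) • unitVec K μ := by
    funext ν
    rw [Finset.sum_apply, Finset.sum_eq_single ν (fun μ _ hμ => by simp [unitVec, hμ]) (fun h => absurd (Finset.mem_univ _) h)]
    simp [unitVec]
  rw [hy]
  induction (Finset.univ : Finset (Fin (d + 1))) using Finset.induction_on with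
  | empty => rw [Finset.sum_empty, add_zero]
  | insert μ s hμ ih => rw [Finset.sum_insert hμ, add_comm ((((y μ).val : ℕ)) • unitVec K μ), ← add_assoc, hstep, ih]

/-- … hence constant: `f x = f 0`. [folklore] -/
theorem eq_apply_zero_of_forall_add_unitVec {α : Type*} {f : Tor K → α} (h : ∀ x μ, f (x + unitVec K μ) = f x) (x : Tor K) : f x = f 0 := by
  have := eq_of_forall_add_unitVec K h 0 x
  rwa [zero_add] at this

end Connected

/-! ## §2 The covariant Dirichlet form -/

section Dirichlet

variable {𝕜 : Type*} [RCLike 𝕜] {n : Type*} [Fintype n] [DecidableEq n]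
variable [hK : ∀ μ, NeZero (K μ)] {c m2 : ℝ}

omit [DecidableEq n] hK in
/-- `Re(star a ⬝ᵥ a) = ‖fib‖²`: the real part of the self-pairing of a component is the squared Euclidean norm of the fibre. [folklore] -/
theorem re_star_dotProduct_comp_self (v : Tor K × n → 𝕜) (x : Tor K) : RCLike.re (star (comp v x) ⬝ᵥ comp v x) = ‖fib K v x‖ ^ 2 := by
  rw [@norm_sq_eq_re_inner 𝕜, EuclideanSpace.inner_eq_star_dotProduct, dotProduct_comm]
  rfl

omit [DecidableEq n] hK in
/-- The two bond terms are complex conjugate: `Re(star a ⬝ᵥ Wb + star b ⬝ᵥ W^*a) = 2Re⟪a, Wb⟫`. [folklore] -/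
theorem re_bond_terms (W : Matrix n n 𝕜) (a b : n → 𝕜) :
    RCLike.re (star a ⬝ᵥ (W *ᵥ b) + star b ⬝ᵥ (Wᴴ *ᵥ a)) = 2 * RCLike.re ⟪(toLp 2 a : EuclideanSpace 𝕜 n), toLp 2 (W *ᵥ b)⟫_𝕜 := by
  have h2 : star b ⬝ᵥ (Wᴴ *ᵥ a) = conj (star a ⬝ᵥ (W *ᵥ b)) := by
    rw [dotProduct_mulVec, ← star_mulVec, Matrix.star_dotProduct, RCLike.star_def]
  rw [h2, map_add, RCLike.conj_re, EuclideanSpace.inner_toLp_toLp, dotProduct_comm, two_mul]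

omit hK in
/-- One bond completed to a square: for unitary `W`, `‖a‖² + ‖b‖² − Re(star a ⬝ᵥ Wb + star b ⬝ᵥ W^*a) = ‖a − Wb‖²`. [folklore] -/
theorem bond_square {W : Matrix n n 𝕜} (hW : W ∈ Matrix.unitaryGroup n 𝕜) (a b : n → 𝕜) :
    ‖(toLp 2 a : EuclideanSpace 𝕜 n)‖ ^ 2 + ‖(toLp 2 b : EuclideanSpace 𝕜 n)‖ ^ 2 - RCLike.re (star a ⬝ᵥ (W *ᵥ b) + star b ⬝ᵥ (Wᴴ *ᵥ a))
      = ‖(toLp 2 a : EuclideanSpace 𝕜 n) - Matrix.toEuclideanLin W (toLp 2 b)‖ ^ 2 := by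
  rw [re_bond_terms, @norm_sub_sq 𝕜, norm_toEuclideanLin_of_mem_unitaryGroup hW, Matrix.toLpLin_toLp, Matrix.toLin'_apply]
  ring

omit [DecidableEq n] in
/-- The site weights collected: `Σ_x c_x Re(star v_x ⬝ᵥ v_x) = (m²+2(d+1)c)Σ_x‖v_x‖²`. [cite: King1986, (4.4) p.670] -/
theorem re_site_sum (c m2 : ℝ) (v : Tor K × n → 𝕜) :
    RCLike.re (∑ x, ((kingHopping K c m2).c x : 𝕜) * (star (comp v x) ⬝ᵥ comp v x)) = (m2 + 2 * ((d : ℝ) + 1) * c) * ∑ x, ‖fib K v x‖ ^ 2 := by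
  rw [map_sum, Finset.mul_sum]
  refine Finset.sum_congr rfl fun x _ => ?_
  rw [RCLike.re_ofReal_mul, re_star_dotProduct_comp_self]
  rfl

omit [DecidableEq n] in
/-- Reindexing the torus by a unit step: `Σ_x‖v_{x+e_μ}‖² = Σ_x‖v_x‖²`. [folklore] -/
theorem sum_norm_fib_add_unitVec (v : Tor K × n → 𝕜) (μ : Fin (d + 1)) : ∑ x, ‖fib K v (x + unitVec K μ)‖ ^ 2 = ∑ x, ‖fib K v x‖ ^ 2 :=
  Fintype.sum_equiv (Equiv.addRight (unitVec K μ)) _ _ fun _ => rfl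

/-- ★★★ **THE COVARIANT DIRICHLET FORM**: for every unitary link field `U`,
`Re⟨v, (−cΔ_U+m²)v⟩ = m²·Σ_x‖v_x‖² + c·Σ_xΣ_μ‖v_x − U(x,μ)v_{x+e_μ}‖²` — the minimally coupled kinetic energy is a sum of squares of covariant differences
(`⟨f, Δ^η_Uf⟩ = ‖D_Uf‖²`, [Balaban1985BackgroundPropagators] (3.3)∕(3.23)), completed from the tree's bond-by-bond `Hopping.quadForm_coupling`.
[cite: Balaban1985BackgroundPropagators, (3.23) p.394; Balaban1982Higgs2, (3.38) p.591; King1986, (4.4) p.670] -/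
theorem re_quadForm_covLapF (c m2 : ℝ) {U : Tor K × Fin (d + 1) → Matrix n n 𝕜} (hU : ∀ b, U b ∈ Matrix.unitaryGroup n 𝕜) (v : Tor K × n → 𝕜) :
    RCLike.re (star v ⬝ᵥ (covLapF K c m2 U *ᵥ v))
      = m2 * ∑ x, ‖fib K v x‖ ^ 2 + c * ∑ x, ∑ μ, ‖fib K v x - Matrix.toEuclideanLin (U (x, μ)) (fib K v (x + unitVec K μ))‖ ^ 2 := by
  rw [show covLapF K c m2 U = (kingHopping K c m2).coupling U from rfl, Hopping.quadForm_coupling, map_sub, re_site_sum]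
  simp only [kingHopping]
  rw [← Finset.mul_sum, RCLike.re_ofReal_mul, map_sum, Fintype.sum_prod_type]
  have hsq : ∀ (x : Tor K) (μ : Fin (d + 1)), ‖fib K v x - Matrix.toEuclideanLin (U (x, μ)) (fib K v (x + unitVec K μ))‖ ^ 2
      = ‖fib K v x‖ ^ 2 + ‖fib K v (x + unitVec K μ)‖ ^ 2
        - RCLike.re (star (comp v x) ⬝ᵥ (U (x, μ) *ᵥ comp v (x + unitVec K μ)) + star (comp v (x + unitVec K μ)) ⬝ᵥ ((U (x, μ))ᴴ *ᵥ comp v x)) :=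
    fun x μ => (bond_square (hU (x, μ)) (comp v x) (comp v (x + unitVec K μ))).symm
  have hR : ∑ x, ∑ μ, ‖fib K v x - Matrix.toEuclideanLin (U (x, μ)) (fib K v (x + unitVec K μ))‖ ^ 2
      = 2 * ((d : ℝ) + 1) * (∑ x, ‖fib K v x‖ ^ 2)
        - ∑ x, ∑ μ, RCLike.re (star (comp v x) ⬝ᵥ (U (x, μ) *ᵥ comp v (x + unitVec K μ))
            + star (comp v (x + unitVec K μ)) ⬝ᵥ ((U (x, μ))ᴴ *ᵥ comp v x)) := by
    simp only [hsq, Finset.sum_sub_distrib, Finset.sum_add_distrib, Finset.sum_const, Finset.card_univ, Fintype.card_fin, nsmul_eq_mul]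
    rw [Finset.sum_comm (f := fun x μ => ‖fib K v (x + unitVec K μ)‖ ^ 2)]
    simp only [sum_norm_fib_add_unitVec, Finset.sum_const, Finset.card_univ, Fintype.card_fin, nsmul_eq_mul, ← Finset.mul_sum]
    push_cast; ring
  rw [hR]
  ring

/-- The form is real: `Im⟨v, M_Uv⟩ = 0` (Hermitian). [folklore] -/
theorem im_quadForm_covLapF (c m2 : ℝ) (U : Tor K × Fin (d + 1) → Matrix n n 𝕜) (v : Tor K × n → 𝕜) :
    RCLike.im (star v ⬝ᵥ (covLapF K c m2 U *ᵥ v)) = 0 :=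
  (isHermitian_covLapF K c m2 U).im_star_dotProduct_mulVec_self v

/-- ★★ `−cΔ_U + m²` IS POSITIVE SEMIDEFINITE for every unitary `U`, `c ≥ 0`, `m² ≥ 0` (in particular the MASSLESS covariant Laplacian).
[cite: Balaban1985BackgroundPropagators, (3.23) p.394; DodziukMathai2006, Cor 1.3 §1] -/
theorem posSemidef_covLapF (hc : 0 ≤ c) (hm : 0 ≤ m2) {U : Tor K × Fin (d + 1) → Matrix n n 𝕜} (hU : ∀ b, U b ∈ Matrix.unitaryGroup n 𝕜) :
    (covLapF K c m2 U).PosSemidef := by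
  refine PosSemidef.of_dotProduct_mulVec_nonneg (isHermitian_covLapF K c m2 U) fun v => RCLike.nonneg_iff.mpr ⟨?_, im_quadForm_covLapF K c m2 U v⟩
  rw [re_quadForm_covLapF K c m2 hU v]
  positivity

end Dirichlet

/-! ## §3 Zero modes of the massless operator are the parallel sections -/

section ZeroModes

variable {𝕜 : Type*} [RCLike 𝕜] {n : Type*} [Fintype n] [DecidableEq n]
variable [hK : ∀ μ, NeZero (K μ)] {c : ℝ}

/-- ★★★ **ZERO MODES = PARALLEL SECTIONS**: for `c > 0` and unitary `U`, `(−cΔ_U)v = 0 ↔ ∀ x μ, v_x = U(x,μ)v_{x+e_μ}` (the Dirichlet form vanishes iff every covariant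
difference does; a positive semidefinite form vanishes iff the operator does). [cite: Balaban1985BackgroundPropagators, (3.23) p.394; DodziukMathai2006, §1] -/
theorem covLapF_massless_mulVec_eq_zero_iff (hc : 0 < c) {U : Tor K × Fin (d + 1) → Matrix n n 𝕜} (hU : ∀ b, U b ∈ Matrix.unitaryGroup n 𝕜)
    (v : Tor K × n → 𝕜) :
    covLapF K c 0 U *ᵥ v = 0 ↔ ∀ x μ, fib K v x = Matrix.toEuclideanLin (U (x, μ)) (fib K v (x + unitVec K μ)) := by
  rw [← (posSemidef_covLapF K hc.le le_rfl hU).dotProduct_mulVec_zero_iff v]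
  constructor
  · intro h x μ
    have hre := congrArg RCLike.re h
    rw [re_quadForm_covLapF K c 0 hU v, map_zero, zero_mul, zero_add, mul_eq_zero] at hre
    rcases hre with hre | hre
    · exact absurd hre hc.ne'
    · have hterm := (Finset.sum_eq_zero_iff_of_nonneg (fun x _ => Finset.sum_nonneg fun μ _ => sq_nonneg _)).mp hre x (Finset.mem_univ _)
      have h2 := (Finset.sum_eq_zero_iff_of_nonneg (fun μ _ => sq_nonneg _)).mp hterm μ (Finset.mem_univ _)
      exact sub_eq_zero.mp (norm_eq_zero.mp ((pow_eq_zero_iff two_ne_zero).mp h2))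
  · intro h
    apply RCLike.ext
    · rw [re_quadForm_covLapF K c 0 hU v, map_zero, zero_mul, zero_add,
        Finset.sum_eq_zero fun x _ => Finset.sum_eq_zero fun μ _ => by rw [← h x μ, sub_self, norm_zero, zero_pow two_ne_zero], mul_zero]
    · rw [im_quadForm_covLapF, map_zero]

/-- ★ A PARALLEL SECTION HAS CONSTANT FIBRE NORM (the transporters are isometries and the torus is connected). [folklore] -/
theorem norm_fib_eq_of_parallel {U : Tor K × Fin (d + 1) → Matrix n n 𝕜} (hU : ∀ b, U b ∈ Matrix.unitaryGroup n 𝕜) {v : Tor K × n → 𝕜}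
    (h : ∀ x μ, fib K v x = Matrix.toEuclideanLin (U (x, μ)) (fib K v (x + unitVec K μ))) (x : Tor K) : ‖fib K v x‖ = ‖fib K v 0‖ :=
  eq_apply_zero_of_forall_add_unitVec K (f := fun z => ‖fib K v z‖)
    (fun z μ => by rw [h z μ, norm_toEuclideanLin_of_mem_unitaryGroup (hU _)]) x

end ZeroModes

/-! ## §4 `U(1)` links: zero modes iff pure gauge; strict diamagnetism of the spectral bottom -/

section AbelianLinks

variable {𝕜 : Type*} [RCLike 𝕜]
variable [hK : ∀ μ, NeZero (K μ)] {c : ℝ}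

omit hK in
/-- For one-component fibres the fibre norm is the modulus of the component. [folklore] -/
theorem norm_fib_unit (v : Tor K × Unit → 𝕜) (x : Tor K) : ‖fib K v x‖ = ‖v (x, ())‖ := by
  rw [EuclideanSpace.norm_eq, Fintype.sum_unique, Real.sqrt_sq (norm_nonneg _)]
  rfl

omit hK in
/-- A `1 × 1` matrix is unitary iff its entry has modulus one. [folklore] -/
theorem mem_unitaryGroup_unit_iff (W : Matrix Unit Unit 𝕜) : W ∈ Matrix.unitaryGroup Unit 𝕜 ↔ ‖W () ()‖ = 1 := by
  rw [Matrix.mem_unitaryGroup_iff']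
  constructor
  · intro h
    have h1 := congr_fun (congr_fun h ()) ()
    rw [Matrix.mul_apply, Fintype.sum_unique, Matrix.one_apply_eq] at h1
    have h2 : (‖W () ()‖ : 𝕜) ^ 2 = 1 := by
      rw [← h1]; simp [RCLike.conj_mul, sq]
    have h3 : ‖W () ()‖ ^ 2 = 1 := by exact_mod_cast h2
    nlinarith [norm_nonneg (W () ()), h3]
  · intro h
    ext i j
    obtain rfl : i = () := rfl
    obtain rfl : j = () := rfl
    rw [Matrix.mul_apply, Fintype.sum_unique, Matrix.one_apply_eq]
    show (star W) () () * W () () = 1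
    rw [Matrix.star_apply, RCLike.star_def, RCLike.conj_mul, h]
    simp

omit hK in
/-- The parallel-transport equation for one-component fibres: `(U·fib)_() = U()()·v`. [folklore] -/
theorem toEuclideanLin_fib_unit (W : Matrix Unit Unit 𝕜) (v : Tor K × Unit → 𝕜) (x : Tor K) :
    (Matrix.toEuclideanLin W (fib K v x)) () = W () () * v (x, ()) := by
  rw [Matrix.toLpLin_apply, PiLp.toLp_apply, Matrix.mulVec, dotProduct, Fintype.sum_unique]
  rfl

/-- ★★★ **ZERO MODES IFF PURE GAUGE** (`U(1)` links, `c > 0`): the massless covariant Laplacian `−cΔ_U` on one-component fields has a non-zero zero mode iff `U` is a pure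
gauge, `U(x,μ) = g(x)·g(x+e_μ)^*` for a `U(1)`-valued site field `g` (= `kingGaugeAct g 1`): a zero mode is a parallel section (§3), it has constant non-zero modulus (§1), and
normalised it IS the gauge; conversely `g` itself is parallel for `g·1·g^*`. [cite: DodziukMathai2006, §1 Cor 1.3; Balaban1985BackgroundPropagators, p.398 l.1–2] -/
theorem exists_zeroMode_iff_pureGauge (hc : 0 < c) {U : Tor K × Fin (d + 1) → Matrix Unit Unit 𝕜} (hU : ∀ b, U b ∈ Matrix.unitaryGroup Unit 𝕜) :
    (∃ v : Tor K × Unit → 𝕜, v ≠ 0 ∧ covLapF K c 0 U *ᵥ v = 0)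
      ↔ ∃ g : Tor K → Matrix Unit Unit 𝕜, (∀ x, g x ∈ Matrix.unitaryGroup Unit 𝕜) ∧ U = kingGaugeAct K g Hopping.free := by
  constructor
  · rintro ⟨v, hv0, hv⟩
    have hpar := (covLapF_massless_mulVec_eq_zero_iff K hc hU v).mp hv
    -- the modulus is a positive constant
    set r := ‖fib K v 0‖ with hr
    have hnorm : ∀ x, ‖v (x, ())‖ = r := fun x => by rw [← norm_fib_unit, norm_fib_eq_of_parallel K hU hpar x]
    have hrpos : 0 < r := by
      obtain ⟨⟨x₀, u⟩, hx₀⟩ := Function.ne_iff.mp hv0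
      obtain rfl : u = () := rfl
      rw [← hnorm x₀]; exact norm_pos_iff.mpr hx₀
    have hvne : ∀ x, v (x, ()) ≠ 0 := fun x h => by have := hnorm x; rw [h, norm_zero] at this; exact hrpos.ne this
    -- the component equation `v(x) = U(x,μ)·v(x+e_μ)`
    have hcomp : ∀ x μ, v (x, ()) = U (x, μ) () () * v (x + unitVec K μ, ()) := fun x μ => by
      have := congrArg (fun w : EuclideanSpace 𝕜 Unit => w ()) (hpar x μ)
      simpa only [fib_apply, toEuclideanLin_fib_unit] using this
    refine ⟨fun x => Matrix.of fun _ _ => ((r : 𝕜)⁻¹) * v (x, ()), fun x => ?_, ?_⟩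
    · dsimp only
      rw [mem_unitaryGroup_unit_iff, Matrix.of_apply, norm_mul, norm_inv, RCLike.norm_ofReal, abs_of_pos hrpos, hnorm x, inv_mul_cancel₀ hrpos.ne']
    · funext ⟨x, μ⟩
      ext i j
      obtain rfl : i = () := rfl
      obtain rfl : j = () := rfl
      simp only [kingGaugeAct, Hopping.free, Matrix.mul_one, Matrix.mul_apply, Fintype.sum_unique, Matrix.conjTranspose_apply, Matrix.of_apply,
        star_mul', RCLike.star_def, map_inv₀, RCLike.conj_ofReal]
      have hv1 := hvne (x + unitVec K μ)
      have hmod : conj (v (x + unitVec K μ, ())) * v (x + unitVec K μ, ()) = (r : 𝕜) ^ 2 := by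
        rw [RCLike.conj_mul, hnorm]
      have hr' : (r : 𝕜) ≠ 0 := by exact_mod_cast hrpos.ne'
      rw [hcomp x μ]
      field_simp
      rw [mul_assoc, mul_comm (v (x + unitVec K μ, ())), hmod]
  · rintro ⟨g, hg, rfl⟩
    refine ⟨fun p => g p.1 () (), ?_, ?_⟩
    · intro h
      have h0 := congr_fun h (0, ())
      have h1 := (mem_unitaryGroup_unit_iff (g 0)).mp (hg 0)
      rw [Pi.zero_apply] at h0
      rw [h0, norm_zero] at h1
      exact zero_ne_one h1
    · refine (covLapF_massless_mulVec_eq_zero_iff K hc (fun b => kingGaugeAct_mem_unitaryGroup K hg (free_mem_unitaryGroup K) b) _).mpr fun x μ => ?_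
      ext i
      obtain rfl : i = () := rfl
      rw [fib_apply, toEuclideanLin_fib_unit]
      simp only [kingGaugeAct, Hopping.free, Matrix.mul_one, Matrix.mul_apply, Fintype.sum_unique, Matrix.conjTranspose_apply, RCLike.star_def]
      have h1 := (mem_unitaryGroup_unit_iff (g (x + unitVec K μ))).mp (hg _)
      rw [mul_assoc, RCLike.conj_mul, h1]
      simp

/-- ★★★ **STRICT DIAMAGNETISM OF THE SPECTRAL BOTTOM** (`U(1)` links, `c > 0`): the massless covariant Laplacian `−cΔ_U` is positive DEFINITE — its lowest eigenvalue is
STRICTLY positive — iff `U` is NOT a pure gauge; on the gauge orbit of `U ≡ 1` (and only there) it has a zero mode.  (A finite-torus sharpening of [DodziukMathai2006] Cor. 1.3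
`λ₀(Δ) ≤ λ₀(Δ_σ)`; what the curved case ADDS to King's `A = 0` fine layer.) [cite: DodziukMathai2006, §1 Cor 1.3; Balaban1985BackgroundPropagators, (3.23) p.394] -/
theorem posDef_covLapF_massless_iff (hc : 0 < c) {U : Tor K × Fin (d + 1) → Matrix Unit Unit 𝕜} (hU : ∀ b, U b ∈ Matrix.unitaryGroup Unit 𝕜) :
    (covLapF K c 0 U).PosDef ↔ ¬ ∃ g : Tor K → Matrix Unit Unit 𝕜, (∀ x, g x ∈ Matrix.unitaryGroup Unit 𝕜) ∧ U = kingGaugeAct K g Hopping.free := by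
  rw [← exists_zeroMode_iff_pureGauge K hc hU]
  constructor
  · rintro hpd ⟨v, hv0, hv⟩
    have := hpd.isUnit
    exact hv0 ((Matrix.mulVec_injective_iff_isUnit.mpr this) (by rw [hv, mulVec_zero]))
  · intro hno
    refine PosDef.of_dotProduct_mulVec_pos (isHermitian_covLapF K c 0 U) fun v hv => ?_
    have hpsd := posSemidef_covLapF K hc.le le_rfl hU
    have hne : star v ⬝ᵥ (covLapF K c 0 U *ᵥ v) ≠ 0 := fun h0 =>
      hno ⟨v, hv, (hpsd.dotProduct_mulVec_zero_iff v).mp h0⟩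
    exact lt_of_le_of_ne (hpsd.dotProduct_mulVec_nonneg v) (Ne.symm hne)

/-- ★ By contrast KING's OWN MASSLESS OPERATOR `c(−Δ) ⊗ 1 = M_1|_{m²=0}` is NOT positive definite: the constants are parallel for `U ≡ 1` (a zero mode on every torus).
[cite: King1986, (4.4) p.670] -/
theorem not_posDef_covLapF_massless_free (hc : 0 < c) :
    ¬ (covLapF K c 0 (Hopping.free : Tor K × Fin (d + 1) → Matrix Unit Unit 𝕜)).PosDef := by
  rw [posDef_covLapF_massless_iff K hc (free_mem_unitaryGroup K), not_not]
  refine ⟨fun _ => 1, fun _ => Submonoid.one_mem _, ?_⟩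
  funext b
  simp [kingGaugeAct, Hopping.free]

end AbelianLinks

end Summit.QuantumFields.YangMills.BalabanUVNodes.N15KingModelRung.Covariant

end
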